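/-
Copyright (c) 2026 the pub-hodgecm-mathlib formalisation cell (harness21).  Prover seat hodgecm-mathlib-LH4-p13 (g8), req620 Track A «(D-RAM) FOUR-FRAME» squad, tier 0,
STAGE-1b (dealer LH4-plan (g13) WORD #91 «B2b-2»; MEMO-B2b2-gluedClassSet v2 999a6f32 §1∕§3): brick (L-lab-20e) «THE NORM SUBGROUP OF THE GLUED REPRESENTATIVE»: the unit
diagonal stabiliser `S̃′(V(1,1,g))` in coordinates, the norms it produces, and the LEVEL CRITERION that puts a σ-fixed unit diagonal into `N′ = N(S̃′(V))` — the input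
`N₀ ≤ N′` of ★ (L-lab-20d) for the product-shaped `N₀`.  2026-09-04.
-/
import Summits.HodgeConjecture.HodgeConjecture.Theorems.F0P3cDyRamDiagonalKappaGluedClass     -- ★ κG (LH4-p09 lineage): `mem_fixedUnitStabilizer_glued_rep_iff`; brings ★ `DiagonalGluedFixedStabiliser`
                                                                                            -- (`mem_latticeStabilizer_latt_glued_exp_iff`, `glued_corner_iff`, `glued_first_of_corner`), ★ DEFS `unitStabilizer`, `unitNormMap`,
                                                                                            -- ★ Literature `WildQuadraticDatumNormSurjective` (`exists_mul_map_eq_of_isRamifiedQuadraticDatum`), `ValuedCompleteIsAdicComplete`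
import Summits.HodgeConjecture.HodgeConjecture.Theorems.F0P3cDyRamUniformizerPowerTube      -- ★ `v_pow_eq_exp_neg`
import HarnessLib

/-!
# Crux `H413`, line LH4 «(D-RAM) FOUR-FRAME», STAGE-1b — (L-lab-20e) «THE NORM SUBGROUP `N(S̃′(V(1,1,g)))` OF THE GLUED REPRESENTATIVE: COORDINATES AND A LEVEL CRITERION»

Cell `hodgecm-mathlib` (D-0151), FLOOR 0, crux item H413 = `stmt-HodgeConjecture-24833`, route of record `HCCMUnconditional`; squad F0∕P3c∕LH4.  THEOREMS ONLY (no `def`, no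
instance, no notation, no `sorry`, default heartbeats), ★-only imports, lane `--supports stmt-HodgeConjecture-24833`.

`V = V(1,1,g) = [[1,0,0],[1,ϖ^ρ,0],[1+g,ϖ^ρ,ϖ^{2ρ+2t′}]]`, `|g| = |ϖ|^{2t′}`, `N′ = (unitStabilizer (latt V)).map (unitNormMap σ 3)`.
* §1 `mem_unitStabilizer_glued_rep_iff` — for a unit diagonal `s`: `s ∈ S̃′(V) ⟺ |s₂ − s₁| ≤ |ϖ|^{ρ+2t′} ∧ |g⁻¹(s₂ − s₁) + (s₂ − s₀)| ≤ |ϖ|^{2ρ}` (the unit twin of ★ κG §4).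
* §2 `norm_coords_mem_map_unitNormMap` — for units `s₀, x` of `K` and `e` with `|x·e| ≤ |ϖ|^{ρ+2t′}`, `|x·(1 + (1+g⁻¹)e) − 1| ≤ |ϖ|^{2ρ}`: the diagonal
  `(N s₀, N s₀·N x, N s₀·N x·N(1+e))` lies in `N′` (MEMO §1's parametrisation `s = s₀·(1, x, x(1+e))`).
* §3 `v_kappa_sub_one_le` — the shear factor `κ(e) = (1 + (1+g⁻¹)(N(1+e) − 1)) ∕ N(1 + (1+g⁻¹)e)` has `κ(e) − 1 = −(1+g⁻¹)g⁻¹N(e) ∕ N(1+(1+g⁻¹)e)`, `|κ(e) − 1| ≤ |e|²·|ϖ|^{−4t′}`;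
  HEAD **`mem_map_unitNormMap_glued_rep_of_levels`** (`[CompleteSpace K]`, ramified datum): a σ-fixed unit diagonal `u` with `u₀` a norm of a unit, `|u₂∕u₁ − 1| ≤ |ϖ|^{L+d−1}` and
  `|w(u) − 1| ≤ |ϖ|^{2ρ+d−1}` (`w(u) = (u₁∕u₀)(1 + (1+g⁻¹)(u₂∕u₁ − 1))`), with `2L − 4t′ ≥ 2ρ + d − 1`, `L ≥ ρ + 2t′`, `2ρ + d − 1 ≥ 2d`, `L + d − 1 ≥ 2d`, lies in `N′` —
  i.e. the PRODUCT-SHAPED level subgroup `N₀` of MEMO v2 §3 satisfies `N₀ ≤ N′` (★ `exists_mul_map_eq_of_isRamifiedQuadraticDatum` three times + §2 + §3).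

HONEST LABEL: count-neutral structure lemmas for the (β-BAL) Stage-B glued orbit; the transversal `R₀` and B3's sum are separate.  HC_CM remains proved only modulo the printed
citations (2 remaining named inputs: hLiu418 = `stmt-HodgeConjecture-24832`, h413 = `stmt-HodgeConjecture-24833`) until rung 0 closes.
-/

noncomputable section

namespace Summit.HodgeConjecture.HodgeConjecture.Cruxes.H413.F0P3cDyRamGluedRepNormSubgroup

open Literature.NumberTheory.Automorphic Literature.NumberTheory.Automorphic.HermitianLattice Literature.NumberTheory.Automorphic.UnitaryGroup
open Literature.NumberTheory.Automorphic.UnitaryLatticeTree Literature.NumberTheory.Automorphic.UnitaryThreeFourFrame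
open Literature.NumberTheory.LocalFields Literature.NumberTheory.LocalFields.WildQuadraticDatum
open Summit.HodgeConjecture.HodgeConjecture.Cruxes.H413.F0P3cDyRamDiagonalTorusDefs
open Summit.HodgeConjecture.HodgeConjecture.Cruxes.H413.F0P3cDyRamDiagonalGluedFixedStabiliser (mem_latticeStabilizer_latt_glued_exp_iff glued_corner_iff glued_first_of_corner)
open Summit.HodgeConjecture.HodgeConjecture.Cruxes.H413.F0P3cDyRamUniformizerPowerTube (v_pow_eq_exp_neg)
open scoped Valued WithZero Matrix MatrixGroups
open WithZero

variable {K : Type} [Field K] [Valued K ℤᵐ⁰]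

/-! ## §1  The unit diagonal stabiliser of `V(1,1,g)` -/

/-- **`S̃′(latt V(1,1,g))`** for a UNIT diagonal `s` (not necessarily σ-fixed): `s ∈ unitStabilizer ⟺ |s₂ − s₁| ≤ |ϖ|^{ρ+2t′} ∧ |g⁻¹(s₂ − s₁) + (s₂ − s₀)| ≤ |ϖ|^{2ρ}`
(★ `mem_latticeStabilizer_latt_glued_exp_iff` at `x = ζ = 1`, `y″ = g`, lineariser `g⁻¹`; the first congruence `|s₁ − s₀| ≤ |ϖ|^ρ` is implied, ★ `glued_first_of_corner`).
[cite: Kottwitz1986BaseChangeUnits, §1 pp. 240–241] [cite: Serre1980Trees, II §1.1] -/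
theorem mem_unitStabilizer_glued_rep_iff {ϖ : K} (hϖ0 : ϖ ≠ 0) (hϖ1 : Valued.v ϖ ≤ 1) (ρ t : ℕ) {g : K} (hg : Valued.v g = Valued.v ϖ ^ (2 * t))
    (V : GL (Fin 3) K) (hV : (V : Matrix (Fin 3) (Fin 3) K) = !![1, 0, 0; 1, ϖ ^ ρ, 0; 1 * 1 + g, ϖ ^ ρ * 1, ϖ ^ (2 * ρ + 2 * t)])
    {s : Fin 3 → Kˣ} (hs : ∀ i, Valued.v (s i : K) = 1) :
    s ∈ unitStabilizer (latt (V : Matrix (Fin 3) (Fin 3) K)) ↔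
      Valued.v ((s 2 : K) - s 1) ≤ Valued.v ϖ ^ (ρ + 2 * t) ∧ Valued.v (g⁻¹ * ((s 2 : K) - s 1) + ((s 2 : K) - s 0)) ≤ Valued.v ϖ ^ (2 * ρ) := by
  have hvϖ : 0 < Valued.v ϖ := (Valuation.pos_iff _).2 hϖ0
  have hg0 : g ≠ 0 := fun h => by rw [h, map_zero] at hg; exact (pow_ne_zero _ hvϖ.ne') hg.symm
  have hg' : Valued.v g⁻¹ * Valued.v ϖ ^ (2 * t) ≤ 1 := by rw [map_inv₀, hg, inv_mul_cancel₀ (pow_ne_zero _ hvϖ.ne')]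
  have hlin : Valued.v ((1 : K) * 1 - g⁻¹ * g) ≤ Valued.v ϖ ^ ρ := by rw [one_mul, inv_mul_cancel₀ hg0, sub_self, map_zero]; exact zero_le
  rw [F0P3cDyRamDiagonalTorusDefs.mem_unitStabilizer_iff, ← mem_latticeStabilizer_iff,
    mem_latticeStabilizer_latt_glued_exp_iff hϖ0 ρ (2 * t) (x := 1) (ζ := 1) (by simp) (by simp) V hV s hs]
  constructor
  · rintro ⟨⟨-, hb, hc⟩, -⟩
    exact ⟨hb, (glued_corner_iff hϖ0 ρ (2 * t) hg hlin hb).1 hc⟩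
  · rintro ⟨hb, hc'⟩
    have hc := (glued_corner_iff hϖ0 ρ (2 * t) hg hlin hb).2 hc'
    refine ⟨⟨?_, hb, hc⟩, hs⟩
    have ha := glued_first_of_corner hϖ1 ρ (2 * t) hg' hb hc'
    rwa [show ((s 2 : K) - s 0) - ((s 2 : K) - s 1) = (s 1 : K) - s 0 by ring] at ha

/-! ## §2  The norms of the stabiliser in the coordinates `s = s₀·(1, x, x(1+e))` -/

/-- **THE COORDINATE ELEMENTS OF `S̃′(V)` AND THEIR NORMS.**  For units `s₀, x` and `e` with `|e| ≤ |ϖ|^{ρ+2t′}` (`ρ ≥ 1`) and `|x(1 + (1+g⁻¹)e) − 1| ≤ |ϖ|^{2ρ}`, the unit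
diagonal `s = (s₀, s₀x, s₀x(1+e))` is in `S̃′(V)` (§1), so `(N s₀, N s₀·N x, N s₀·N x·N(1+e)) ∈ N′` (MEMO-B2b2 §1∕§2). [cite: Kottwitz1986BaseChangeUnits, §1 pp. 240–241] -/
theorem norm_coords_mem_map_unitNormMap (σ : K →+* K) {ϖ : K} (hϖ : Valued.v ϖ = exp (-1 : ℤ)) {ρ : ℕ} (hρ : 1 ≤ ρ) (t : ℕ)
    {g : K} (hg : Valued.v g = Valued.v ϖ ^ (2 * t))
    (V : GL (Fin 3) K) (hV : (V : Matrix (Fin 3) (Fin 3) K) = !![1, 0, 0; 1, ϖ ^ ρ, 0; 1 * 1 + g, ϖ ^ ρ * 1, ϖ ^ (2 * ρ + 2 * t)])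
    {s₀ x e : K} (hs₀ : Valued.v s₀ = 1) (hx : Valued.v x = 1) (he : Valued.v e ≤ Valued.v ϖ ^ (ρ + 2 * t))
    (hcorner : Valued.v (x * (1 + (1 + g⁻¹) * e) - 1) ≤ Valued.v ϖ ^ (2 * ρ))
    (u : Fin 3 → Kˣ) (hu0 : (u 0 : K) = s₀ * σ s₀) (hu1 : (u 1 : K) = s₀ * σ s₀ * (x * σ x)) (hu2 : (u 2 : K) = s₀ * σ s₀ * (x * σ x) * ((1 + e) * σ (1 + e))) :
    u ∈ (unitStabilizer (latt (V : Matrix (Fin 3) (Fin 3) K))).map (unitNormMap σ 3) := by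
  have hϖ0 : ϖ ≠ 0 := (Valuation.ne_zero_iff Valued.v).1 (by rw [hϖ]; exact exp_ne_zero)
  have hϖ1 : Valued.v ϖ < 1 := by rw [hϖ, ← exp_zero, exp_lt_exp]; norm_num
  have hs₀0 : s₀ ≠ 0 := fun h => by rw [h, map_zero] at hs₀; exact zero_ne_one hs₀
  have hx0 : x ≠ 0 := fun h => by rw [h, map_zero] at hx; exact zero_ne_one hx
  have he1 : Valued.v e < 1 := he.trans_lt (pow_lt_one₀ zero_le hϖ1 (by omega))
  have h1e : Valued.v (1 + e) = 1 := Valued.v.map_one_add_of_lt he1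
  have h1e0 : 1 + e ≠ 0 := fun h => by rw [h, map_zero] at h1e; exact zero_ne_one h1e
  -- the unit diagonal `s = (s₀, s₀x, s₀x(1+e))`
  let s : Fin 3 → Kˣ := ![Units.mk0 s₀ hs₀0, Units.mk0 (s₀ * x) (mul_ne_zero hs₀0 hx0), Units.mk0 (s₀ * x * (1 + e)) (mul_ne_zero (mul_ne_zero hs₀0 hx0) h1e0)]
  have hsv0 : (s 0 : K) = s₀ := rfl
  have hsv1 : (s 1 : K) = s₀ * x := rfl
  have hsv2 : (s 2 : K) = s₀ * x * (1 + e) := rfl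
  have hsu : ∀ i, Valued.v (s i : K) = 1 := fun i => by
    fin_cases i
    · show Valued.v (s 0 : K) = 1; rw [hsv0, hs₀]
    · show Valued.v (s 1 : K) = 1; rw [hsv1, map_mul, hs₀, hx, mul_one]
    · show Valued.v (s 2 : K) = 1; rw [hsv2, map_mul, map_mul, hs₀, hx, h1e, mul_one, mul_one]
  have hsS : s ∈ unitStabilizer (latt (V : Matrix (Fin 3) (Fin 3) K)) := by
    rw [mem_unitStabilizer_glued_rep_iff hϖ0 hϖ1.le ρ t hg V hV hsu, hsv0, hsv1, hsv2]
    constructor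
    · rw [show s₀ * x * (1 + e) - s₀ * x = s₀ * (x * e) by ring, map_mul, hs₀, one_mul, map_mul, hx, one_mul]; exact he
    · rw [show g⁻¹ * (s₀ * x * (1 + e) - s₀ * x) + (s₀ * x * (1 + e) - s₀) = s₀ * (x * (1 + (1 + g⁻¹) * e) - 1) by ring, map_mul, hs₀, one_mul]
      exact hcorner
  refine ⟨s, hsS, funext fun i => Units.ext ?_⟩
  rw [unitNormMap_apply]
  fin_cases i
  · show (s 0 : K) * σ (s 0 : K) = u 0; rw [hsv0, hu0]
  · show (s 1 : K) * σ (s 1 : K) = u 1; rw [hsv1, hu1, map_mul]; ring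
  · show (s 2 : K) * σ (s 2 : K) = u 2; rw [hsv2, hu2, map_mul, map_mul]; ring

/-! ## §3  The shear factor and the level criterion `N₀ ≤ N′` -/

omit [Valued K ℤᵐ⁰] in
/-- **THE SHEAR FACTOR `κ(e) − 1 = −(1+g⁻¹)·g⁻¹·N(e) ∕ N(1+(1+g⁻¹)e)`** (`e_F := N(1+e) − 1 = Tr e + N e`; `σ` fixes `g`): pure algebra. [cite: Kottwitz1986BaseChangeUnits, §1 pp. 240–241] -/
theorem kappa_sub_one_eq (σ : K →+* K) {g e : K} (hσg : σ g = g) (hN : (1 + (1 + g⁻¹) * e) * σ (1 + (1 + g⁻¹) * e) ≠ 0) :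
    (1 + (1 + g⁻¹) * ((1 + e) * σ (1 + e) - 1)) / ((1 + (1 + g⁻¹) * e) * σ (1 + (1 + g⁻¹) * e)) - 1 =
      -((1 + g⁻¹) * g⁻¹ * (e * σ e)) / ((1 + (1 + g⁻¹) * e) * σ (1 + (1 + g⁻¹) * e)) := by
  rw [div_sub_one hN]
  congr 1
  simp only [map_add, map_one, map_mul, map_inv₀, hσg]
  ring

/-- **`|κ(e) − 1| ≤ |e|²·|g|⁻²`** when `|g| < 1`, `|(1+g⁻¹)e| < 1`. [cite: Serre1979, Ch. V §3 Cor. 3] -/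
theorem v_kappa_sub_one_le (σ : K →+* K) (hvσ : ∀ a, Valued.v (σ a) = Valued.v a) {g e : K} (hσg : σ g = g) (hg0 : g ≠ 0) (hg1 : Valued.v g < 1)
    (hce : Valued.v ((1 + g⁻¹) * e) < 1) :
    Valued.v ((1 + (1 + g⁻¹) * ((1 + e) * σ (1 + e) - 1)) / ((1 + (1 + g⁻¹) * e) * σ (1 + (1 + g⁻¹) * e)) - 1) ≤
      Valued.v e * Valued.v e * (Valued.v g)⁻¹ * (Valued.v g)⁻¹ := by
  have h1 : Valued.v (1 + (1 + g⁻¹) * e) = 1 := Valued.v.map_one_add_of_lt hce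
  have h2 : Valued.v (σ (1 + (1 + g⁻¹) * e)) = 1 := by rw [hvσ, h1]
  have hN : (1 + (1 + g⁻¹) * e) * σ (1 + (1 + g⁻¹) * e) ≠ 0 := by
    refine mul_ne_zero ?_ ?_
    · intro h; rw [h, map_zero] at h1; exact zero_ne_one h1
    · intro h; rw [h, map_zero] at h2; exact zero_ne_one h2
  have hc : Valued.v (1 + g⁻¹) = (Valued.v g)⁻¹ := by
    have hlt : Valued.v (1 : K) < Valued.v g⁻¹ := by rw [map_one, map_inv₀]; exact one_lt_inv_iff₀.2 ⟨(Valuation.pos_iff _).2 hg0, hg1⟩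
    rw [Valuation.map_add_eq_of_lt_right _ hlt, map_inv₀]
  rw [kappa_sub_one_eq σ hσg hN, map_div₀, show Valued.v ((1 + (1 + g⁻¹) * e) * σ (1 + (1 + g⁻¹) * e)) = 1 by rw [map_mul, h1, h2, mul_one],
    div_one, Valuation.map_neg]
  simp only [map_mul, map_inv₀, hvσ, hc]
  simp only [mul_comm, mul_assoc, mul_left_comm, le_refl]

/-- **HEAD — THE LEVEL CRITERION `N₀ ≤ N′` FOR THE GLUED REPRESENTATIVE.**  Complete `K`, ramified quadratic datum; `V = V(1,1,g)` (`ρ ≥ 1`, `|g| = |ϖ|^{2t′}`, `t′ ≥ 1`, `σg = g`).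
A σ-fixed unit diagonal `u` with `u₀` the norm of a unit, `|u₂∕u₁ − 1| ≤ |ϖ|^{L+d−1}` and `|w(u) − 1| ≤ |ϖ|^{2ρ+d−1}`, `w(u) = (u₁∕u₀)(1 + (1+g⁻¹)(u₂∕u₁ − 1))` — with
`ρ + 2t′ ≤ L`, `2ρ + d − 1 + 4t′ ≤ 2L`, `2d ≤ 2ρ + d − 1`, `2d ≤ L + d − 1` — lies in `N′ = N(S̃′(V))`: `u₂∕u₁ = N(1+e)` with `|e| ≤ |ϖ|^L` and `w(u)∕κ(e) = N(x′)` with `|x′ − 1| ≤ |ϖ|^{2ρ}`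
(★ `exists_mul_map_eq_of_isRamifiedQuadraticDatum` twice; `|κ(e) − 1| ≤ |ϖ|^{2L−4t′} ≤ |ϖ|^{2ρ+d−1}`), then §2 with `x = x′∕(1+(1+g⁻¹)e)`.  This is `N₀ ≤ N′` for the PRODUCT
level subgroup `N₀` of MEMO-B2b2 v2 §3 (the input of ★ (L-lab-20d)). [cite: Serre1979, Ch. V §3 Prop. 5, Cor. 3] [cite: Kottwitz1986BaseChangeUnits, §1 pp. 240–241] -/
theorem mem_map_unitNormMap_glued_rep_of_levels [CompleteSpace K] {σ : K →+* K} {ϖ : K} {d t₂ : ℕ} (hD : IsRamifiedQuadraticDatum σ ϖ d t₂)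
    {ρ : ℕ} (hρ : 1 ≤ ρ) {t : ℕ} (ht : 1 ≤ t) {g : K} (hσg : σ g = g) (hg : Valued.v g = Valued.v ϖ ^ (2 * t))
    (V : GL (Fin 3) K) (hV : (V : Matrix (Fin 3) (Fin 3) K) = !![1, 0, 0; 1, ϖ ^ ρ, 0; 1 * 1 + g, ϖ ^ ρ * 1, ϖ ^ (2 * ρ + 2 * t)])
    {u : Fin 3 → Kˣ} (hσu : ∀ i, σ (u i : K) = u i)
    (h0 : ∃ z₀ : K, Valued.v z₀ = 1 ∧ z₀ * σ z₀ = u 0)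
    {L : ℕ} (hL1 : ρ + 2 * t ≤ L) (hL2 : 2 * ρ + d - 1 + 4 * t ≤ 2 * L) (hρd : 2 * d ≤ 2 * ρ + d - 1) (hLd : 2 * d ≤ L + d - 1)
    (h21 : Valued.v ((u 2 : K) / u 1 - 1) ≤ Valued.v ϖ ^ (L + d - 1))
    (hw : Valued.v ((u 1 : K) / u 0 * (1 + (1 + g⁻¹) * ((u 2 : K) / u 1 - 1)) - 1) ≤ Valued.v ϖ ^ (2 * ρ + d - 1)) :
    u ∈ (unitStabilizer (latt (V : Matrix (Fin 3) (Fin 3) K))).map (unitNormMap σ 3) := by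
  obtain ⟨hσ, hvσ, hϖ, hfix, hdd, h1d, -⟩ := id hD
  haveI : IsAdicComplete 𝓂[K] 𝒪[K] := isAdicComplete_valuedInteger_of_completeSpace hϖ
  have hϖ0 : ϖ ≠ 0 := (Valuation.ne_zero_iff Valued.v).1 (by rw [hϖ]; exact exp_ne_zero)
  have hvϖ : 0 < Valued.v ϖ := (Valuation.pos_iff _).2 hϖ0
  have hϖ1 : Valued.v ϖ < 1 := by rw [hϖ, ← exp_zero, exp_lt_exp]; norm_num
  have hq : ∀ n : ℕ, Valued.v ϖ ^ n = exp (-(n : ℤ)) := fun n => by rw [← map_pow, v_pow_eq_exp_neg hϖ]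
  have hpow_le : ∀ {m n : ℕ}, n ≤ m → Valued.v ϖ ^ m ≤ Valued.v ϖ ^ n := fun h => pow_le_pow_right_of_le_one' hϖ1.le h
  have hg0 : g ≠ 0 := fun h => by rw [h, map_zero] at hg; exact (pow_ne_zero _ hvϖ.ne') hg.symm
  have hg1 : Valued.v g < 1 := by rw [hg]; exact pow_lt_one₀ zero_le hϖ1 (by omega)
  have hu0' : (u 0 : K) ≠ 0 := (u 0).ne_zero
  have hu1' : (u 1 : K) ≠ 0 := (u 1).ne_zero
  set c : K := 1 + g⁻¹ with hc
  have hσc : σ c = c := by rw [hc, map_add, map_one, map_inv₀, hσg]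
  have hvc : Valued.v c = (Valued.v g)⁻¹ := by
    have hlt : Valued.v (1 : K) < Valued.v g⁻¹ := by rw [map_one, map_inv₀]; exact one_lt_inv_iff₀.2 ⟨(Valuation.pos_iff _).2 hg0, hg1⟩
    rw [hc, Valuation.map_add_eq_of_lt_right _ hlt, map_inv₀]
  -- ### (1) `u₂∕u₁ = N(1+e)` with `|e| ≤ |ϖ|^L`
  have hσ21 : σ ((u 2 : K) / u 1) = (u 2 : K) / u 1 := by rw [map_div₀, hσu, hσu]
  obtain ⟨y, hy, hy1⟩ := exists_mul_map_eq_of_isRamifiedQuadraticDatum σ ϖ d t₂ hD _ hσ21 (h21.trans (hpow_le hLd))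
  set e : K := y - 1 with he_def
  have hye : y = 1 + e := by rw [he_def]; ring
  have he : Valued.v e ≤ Valued.v ϖ ^ L := by
    have h1 : Valued.v e * Valued.v ϖ ^ d ≤ Valued.v ϖ ^ (L + d - 1) * Valued.v ϖ := hy1.trans (mul_le_mul_left h21 _)
    rw [← pow_succ, show L + d - 1 + 1 = L + d by omega, pow_add] at h1
    exact le_of_mul_le_mul_right h1 (pow_pos hvϖ d)
  have heρ : Valued.v e ≤ Valued.v ϖ ^ (ρ + 2 * t) := he.trans (hpow_le hL1)
  have hce : Valued.v (c * e) < 1 := by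
    rw [map_mul, hvc, hg]
    calc (Valued.v ϖ ^ (2 * t))⁻¹ * Valued.v e ≤ (Valued.v ϖ ^ (2 * t))⁻¹ * Valued.v ϖ ^ (ρ + 2 * t) := mul_le_mul_right heρ _
      _ = Valued.v ϖ ^ ρ := by rw [pow_add, mul_comm (Valued.v ϖ ^ ρ), ← mul_assoc, inv_mul_cancel₀ (pow_ne_zero _ hvϖ.ne'), one_mul]
      _ < 1 := pow_lt_one₀ zero_le hϖ1 (by omega)
  have h1ce : Valued.v (1 + c * e) = 1 := Valued.v.map_one_add_of_lt hce
  have h1ce0 : 1 + c * e ≠ 0 := fun h => by rw [h, map_zero] at h1ce; exact zero_ne_one h1ce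
  have hσ1ce : Valued.v (σ (1 + c * e)) = 1 := by rw [hvσ, h1ce]
  have hσ1ce0 : σ (1 + c * e) ≠ 0 := fun h => by rw [h, map_zero] at hσ1ce; exact zero_ne_one hσ1ce
  have hNce0 : (1 + c * e) * σ (1 + c * e) ≠ 0 := mul_ne_zero h1ce0 hσ1ce0
  -- ### (2) the shear factor `κ(e)` is a deep fixed unit
  set κ : K := (1 + c * ((1 + e) * σ (1 + e) - 1)) / ((1 + c * e) * σ (1 + c * e)) with hκ
  have hσκ : σ κ = κ := by
    simp only [hκ, map_div₀, map_add, map_one, map_mul, map_sub, hσc, hσ]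
    ring
  have hκ1 : Valued.v (κ - 1) ≤ Valued.v ϖ ^ (2 * ρ + d - 1) := by
    have h := v_kappa_sub_one_le σ hvσ (e := e) hσg hg0 hg1 hce
    refine h.trans ?_
    rw [hg]
    calc Valued.v e * Valued.v e * (Valued.v ϖ ^ (2 * t))⁻¹ * (Valued.v ϖ ^ (2 * t))⁻¹
        ≤ Valued.v ϖ ^ L * Valued.v ϖ ^ L * (Valued.v ϖ ^ (2 * t))⁻¹ * (Valued.v ϖ ^ (2 * t))⁻¹ := by
          gcongr
      _ = Valued.v ϖ ^ (2 * L - 4 * t) := by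
          rw [hq, hq, hq, ← exp_neg, ← exp_add, ← exp_add, ← exp_add]; congr 1; push_cast; omega
      _ ≤ Valued.v ϖ ^ (2 * ρ + d - 1) := hpow_le (by omega)
  have hκv : Valued.v κ = 1 := by
    have hlt : Valued.v (κ - 1) < 1 := hκ1.trans_lt (pow_lt_one₀ zero_le hϖ1 (by omega))
    have h := Valuation.map_add_eq_of_lt_left Valued.v (x := (1 : K)) (y := κ - 1) (by rw [map_one]; exact hlt)
    rwa [add_sub_cancel, map_one] at h
  have hκ0 : κ ≠ 0 := fun h => by rw [h, map_zero] at hκv; exact zero_ne_one hκv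
  -- ### (3) `w(u)∕κ = N(x′)` with `|x′ − 1| ≤ |ϖ|^{2ρ}`
  set wF : K := (u 1 : K) / u 0 * (1 + c * ((u 2 : K) / u 1 - 1)) with hwF
  have hσwF : σ wF = wF := by simp only [hwF, map_mul, map_div₀, map_add, map_one, map_sub, hσu, hσc]
  have hwv : Valued.v wF = 1 := by
    have hlt : Valued.v (wF - 1) < 1 := hw.trans_lt (pow_lt_one₀ zero_le hϖ1 (by omega))
    have h := Valuation.map_add_eq_of_lt_left Valued.v (x := (1 : K)) (y := wF - 1) (by rw [map_one]; exact hlt)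
    rwa [add_sub_cancel, map_one] at h
  have htarget : Valued.v (wF / κ - 1) ≤ Valued.v ϖ ^ (2 * ρ + d - 1) := by
    rw [show wF / κ - 1 = ((wF - 1) - (κ - 1)) / κ by field_simp; ring, map_div₀, hκv, div_one]
    exact (Valuation.map_sub _ _ _).trans (max_le hw hκ1)
  obtain ⟨x', hx', hx'1⟩ := exists_mul_map_eq_of_isRamifiedQuadraticDatum σ ϖ d t₂ hD _ (by rw [map_div₀, hσwF, hσκ]) (htarget.trans (hpow_le hρd))
  have hx'v1 : Valued.v (x' - 1) ≤ Valued.v ϖ ^ (2 * ρ) := by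
    have h1 : Valued.v (x' - 1) * Valued.v ϖ ^ d ≤ Valued.v ϖ ^ (2 * ρ + d - 1) * Valued.v ϖ := hx'1.trans (mul_le_mul_left htarget _)
    rw [← pow_succ, show 2 * ρ + d - 1 + 1 = 2 * ρ + d by omega, pow_add] at h1
    exact le_of_mul_le_mul_right h1 (pow_pos hvϖ d)
  have hx'v : Valued.v x' = 1 := by
    have hlt : Valued.v (x' - 1) < 1 := hx'v1.trans_lt (pow_lt_one₀ zero_le hϖ1 (by omega))
    have h := Valuation.map_add_eq_of_lt_left Valued.v (x := (1 : K)) (y := x' - 1) (by rw [map_one]; exact hlt)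
    rwa [add_sub_cancel, map_one] at h
  -- ### (4) the coordinates `s₀ = z₀`, `x = x′∕(1 + c e)`, `e`
  obtain ⟨z₀, hz₀v, hz₀⟩ := h0
  set x : K := x' / (1 + c * e) with hxdef
  have hxv : Valued.v x = 1 := by rw [hxdef, map_div₀, hx'v, h1ce, div_one]
  have hcorner : Valued.v (x * (1 + (1 + g⁻¹) * e) - 1) ≤ Valued.v ϖ ^ (2 * ρ) := by
    rw [← hc, hxdef, div_mul_cancel₀ x' h1ce0]; exact hx'v1
  have hN1e : (1 + e) * σ (1 + e) = (u 2 : K) / u 1 := by rw [← hye]; exact hy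
  have hwF0 : wF ≠ 0 := fun h => by rw [h, map_zero] at hwv; exact zero_ne_one hwv
  have hfac : 1 + c * ((u 2 : K) / u 1 - 1) ≠ 0 := by
    intro h
    apply hwF0
    rw [hwF, h, mul_zero]
  have hNx : x * σ x = (u 1 : K) / u 0 := by
    rw [hxdef, map_div₀, div_mul_div_comm, hx', hκ, hN1e, hwF]
    have hden : (u 1 : K) + c * ((u 2 : K) - u 1) ≠ 0 := by
      intro h
      apply hfac
      have : 1 + c * ((u 2 : K) / u 1 - 1) = ((u 1 : K) + c * ((u 2 : K) - u 1)) / u 1 := by field_simp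
      rw [this, h, zero_div]
    field_simp
  refine norm_coords_mem_map_unitNormMap σ hϖ hρ t hg V hV hz₀v hxv heρ hcorner u hz₀.symm ?_ ?_
  · rw [hz₀, hNx, mul_div_cancel₀ _ hu0']
  · rw [hz₀, hNx, mul_div_cancel₀ _ hu0', ← hye, hy, mul_div_cancel₀ _ hu1']

end Summit.HodgeConjecture.HodgeConjecture.Cruxes.H413.F0P3cDyRamGluedRepNormSubgroup

end
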